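import Summits.QuantumFields.BalabanUV.Beta.GAN24.TaylorRowLamTableSymAt
import Summits.QuantumFields.BalabanUV.Beta.GAN24.TaylorRowLam
import Summits.QuantumFields.BalabanUV.Beta.GAN24.E3UnitSplitLevelsSymAt

/-!
# Road «S3-Taylor», Λ SHAPE rows AT THE SYM TABLE, part 3 of 3: the END **`rowL_three_at`** — row S3-L for the SYMMETRISED Lagrange increment `symLagrIncAt 3 (toSite r) Lc`,
# constants BEFORE the root (sym twin of leaf-06 g40's (ρ-c) `TaylorRowLamAt`; the sym twin of the OWNER's (Λ-U) `BornLambdaUndressedRow.exists_hUg_of_rootedRows` will consume it BY NAME)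

NOT IN PRINT — OUR BOOKKEEPING (road-P2 = `b2b-balaban-gan24-p2` gen 56, 2026-08-25; row G-an2-4 ∕ (CONV-C), the (α-0) chain at row D1's literal
OF RECORD (III′) `JsB12CombShSym`; [folklore] composition BY NAME; 0 `def`, 0 cite, 0 `def … : Prop`, 0 `sorry`).  Weight 0.  NEVER «G-an2-4 closed» as (CONV-C);
NOT D1, NOT BetaPertH, NOT continuum, NOT Clay; NO campaign opened (an2 W-4) — typed while idle under R-2 as a brick of the located `hUg-Λ` transfer
(road-P2 MEMO M-gan24p2-g56-1, `gen56/S-CAMPAIGN-SIZING-g56.v0_4.md` §2(a)).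

METHOD = the OWNER gan24-p1's gen-6 `mkroot.py` rule (road-P2's `tools/mksym.py`): leaf-06 g40's (ρ-c) file VERBATIM with an1's SYM table `symHessFFAt (toSite r) Lc`
(`r ∈ box (d+1) Lc`) in place of the rooted `hessFFAt (toSite r) Lc` and the symmetrised increment `E3UnitSplitLevelsSymAt.symLagrIncAt` (M.66) in place of asym's
`SpineRooted.lagrIncAt`; the table enters ONLY through (ρ-a)-sym `TaylorMassLamSymAt` (M.65: `abs_avgLift_symHessFFAt_le ∕ avgLift_symHessFFAt_ne_zero` — SAME constants and radius
as (ρ-a)) and (ρ-b)-sym `E3UnitSplitLevelsSymAt.e3Lam_unit_split`; every ROOT-FREE lemma of the base modules is used BY NAME (not re-declared); same theorem names in the namespace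
`TaylorRowLamSymAt`; base and rooted modules untouched; no zero-root sanity `example` (the sym table has no root-0 base twin).
Discharges NOTHING of (hS, hSall), the K-slot or BetaPertH by itself.

## Contents (`d` generic in §4, `d = 3` in §5; root `r ∈ box (d+1) Lc`)
§4-σ `piece_eq_pref_mul_sandwich`, **`abs_lam_piece_le`** (the Λ piece of level `ℓ` pushed `k` times is `≤ K·(Lc⁻¹)^k` in `LocStencil` shape, `K` free of `ℓ, k` and of the root);
§5-σ `rowL_of_legs_at`, END **`rowL_three_at (cΛ) : ∃ cL δL, 0 < δL ∧ ∀ r ∈ box (3+1) Lc, ∀ n m, m < n → LocStencil (… e3OfS (Lc^(n+2)) ((Lc^4)^{n−m}·cΛ·(Lc^(m+1))^{10} • symLagrIncAt 3 (toSite r) Lc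
(Lc^(m+1)) (Lc^(m+2))) …) (cL·(Lc⁻¹)^{n−m}) δL`** — UNCONDITIONAL at `d = 3` (the TREE theorems `StencilSlotE3HLeg.legs_three` ((N1) inside) and `StencilSlotE3PhiLeg.phiLeg_three`
(the K-slot inside), exactly as at (E)).
-/

noncomputable section

open Finset
open scoped BigOperators
open Literature.MathematicalPhysics.QuantumFieldTheory
open Literature.MathematicalPhysics.QuantumFieldTheory.Balaban1983to89
open Literature.MathematicalPhysics.QuantumFieldTheory.Balaban1983to89.Beta
open Literature.Probability.LatticeModels (Torus.proj Torus.proj_apply)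
open AffineAveraging (Site Form1 unitVec unitVec_apply box toSite)
open AffineReproduction (contourSumAdj)
open LatticeForm (quo)
open B12Sec2to5 (l1 l1_nonneg)
open ExpKernelCalculus (MKer Zl BiLoc l1_sub_triangle l1_sub_symm l1_natSmul)
open OneStepResolventKernel (Fib KInv LocStencil proj_zsmul quo_zsmul eq_zsmul_quo_of_proj KInv_inr_inr_coarse)
open KernelSpecInstance (wH wΦ)
open KKTFluctuationKernel (GamΦ)
open InterLevelTransport (SLam avgLift cwsum cwsum_apply onLat onLat_zsmul onLat_off)
open BalabanStepJets (lamCoeffOf)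
open BalabanCompositeJets (lagrInc)
open AveragingHessianKernels (hessFF ell)
open Summit.QuantumFields.BalabanUV.Beta.GAN24.E3UnitSplit (e3OfS e3OfS_inl_inr e3OfS_inr)
open Summit.QuantumFields.BalabanUV.Beta.GAN24.E3UnitSplitLevelsSymAt (e3Lam_unit_split)
open Summit.QuantumFields.BalabanUV.Beta.GAN24.TaylorRowLamSymAt (inner_eq abs_sandwich_le)
open Summit.QuantumFields.BalabanUV.Beta.GAN24.TaylorLamVertexPairing (vertexPair_eq summable_wH_mul_lamCoeffOf quo_quo
  abs_contourSumAdj_le_exp)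
open Summit.QuantumFields.BalabanUV.Beta.GAN24.TaylorSandwich (sandwich_bound)
open Summit.QuantumFields.BalabanUV.Beta.SymAveragingHessianCounts (symHessFFAt symHessKerAt symHessFFAt_inl_inl symHessFFAt_inl_inr symHessFFAt_inr
  symHessKerAt_eq_zero_left symHessKerAt_eq_zero_right abs_symHessKerAt_le biLoc_symHessFFAt)
open Summit.QuantumFields.BalabanUV.Beta.GAN24.E3UnitSplitLevelsSymAt (symLagrIncAt)
open Summit.QuantumFields.BalabanUV.Beta.GAN24.TaylorMassLamSymAt (abs_avgLift_symHessFFAt_le avgLift_symHessFFAt_ne_zero)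
open Summit.QuantumFields.BalabanUV.Beta.GAN24.TaylorRowLam (power_count inv_pow_succ_succ mul_exp_mono_rate)
open Summit.QuantumFields.BalabanUV.Beta.GAN24.TaylorBlockSum (abs_ediv_sub_ediv_le nonneg_of_dominated)
open Summit.QuantumFields.BalabanUV.Beta.GAN24.StencilSlotE3PhiLeg (phiLeg_three)
open Summit.QuantumFields.BalabanUV.Beta.GAN24.StencilSlotE3HLeg (legs_three)

namespace Summit.QuantumFields.BalabanUV.Beta.GAN24.TaylorRowLamSymAt

variable {d : ℕ}

/-! ## §4 The Λ piece of level `ℓ` pushed `k` times is `≤ K·(Lc⁻¹)^k` in `LocStencil` shape (`K` free of `ℓ`, `k`) -/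

section Piece

variable {Lc : ℕ} [NeZero Lc] {r : Fin (d + 1) → ℕ}

/-- [folklore] **THE PIECE AS A PREFACTOR TIMES THE REWRITTEN SANDWICH** (ff block): `e3Lam_unit_split` (leaf-01) followed by the inner
identity `inner_eq` under the outer legs; all blockings displayed through `((Lc^(ℓ+k+1) : ℕ) : ℝ)`. -/
theorem piece_eq_pref_mul_sandwich (hr : r ∈ box (d + 1) Lc) (cΛ : ℝ) (ℓ k p : ℕ) (hp : p = ℓ + k + 1) (κ' : Fin (d + 1)) (u' x' z' : Site (d + 1)) (α β : Fin (d + 1)) :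
    ((Lc : ℝ) ^ p) ^ (2 * (d + 1)) *
        e3OfS (Lc ^ p) (fun κ u => (((Lc : ℝ) ^ (d + 1)) ^ k * (cΛ * ((Lc : ℝ) ^ ℓ) ^ (2 * d + 4))) •
          symLagrIncAt d (toSite r) Lc (Lc ^ ℓ) (Lc ^ (ℓ + 1)) κ u) κ' u' x' z' (Sum.inl α) (Sum.inl β) =
      -(cΛ / (Lc : ℝ) ^ (d + 1)) * (((Lc ^ p : ℕ) : ℝ)) ^ ((d : ℤ) - 2) * ((Lc : ℝ) ^ ℓ) ^ (d + 3) *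
        ∑' y : Site (d + 1), ∑ l' : Fin (d + 1),
          (∑' w : Site (d + 1), ∑ l : Fin (d + 1),
              ((((Lc ^ p : ℕ) : ℝ)) ^ (d + 2) * GamΦ (N := Lc ^ p) α x' l w) *
                ∑ μ : Fin (d + 1), ((((Lc ^ p : ℕ) : ℝ)) ^ (d + 1))⁻¹ * ∑' v : Site (d + 1),
                  onLat (Lc ^ (ℓ + 1)) (fun Y => (((Lc ^ p : ℕ) : ℝ)) ^ (d + 2) *
                      contourSumAdj (Lc ^ k) (fun κ₁ q => wΦ (N := Lc ^ p) κ₁ κ' (q - u')) μ Y) v *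
                    onLat (Lc ^ (ℓ + 1)) (fun Y => avgLift (Lc ^ ℓ) (symHessFFAt (toSite r) Lc μ Y)) v w y (Sum.inl l) (Sum.inl l')) *
            ((((Lc ^ p : ℕ) : ℝ)) ^ (d + 2) *
              wH (N := Lc ^ p) l' β (y - ((Lc ^ p : ℕ) : ℤ) • z')) := by
  subst hp
  haveI hN0 : NeZero (Lc ^ (ℓ + k + 1)) := ⟨pow_ne_zero _ (NeZero.ne Lc)⟩
  haveI hNp0 : NeZero (Lc ^ (ℓ + 1)) := ⟨pow_ne_zero _ (NeZero.ne Lc)⟩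
  haveI hM0 : NeZero (Lc ^ ℓ) := ⟨pow_ne_zero _ (NeZero.ne Lc)⟩
  have hNR : Lc ^ (ℓ + k + 1) = Lc ^ (ℓ + 1) * Lc ^ k := by rw [← pow_add]; ring_nf
  have hcast : (((Lc ^ (ℓ + k + 1) : ℕ) : ℝ)) = (Lc : ℝ) ^ (ℓ + k + 1) := by push_cast; rfl
  rw [e3Lam_unit_split (toSite r) cΛ ℓ k (ℓ + k + 1) rfl κ' u' x' z' α β, ← hcast]
  have hin := fun w y l l' => inner_eq (d := d) (Lc := Lc) hr (N := Lc ^ (ℓ + k + 1)) (N' := Lc ^ (ℓ + 1)) (M := Lc ^ ℓ)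
    (R := Lc ^ k) hNR κ' u' w y l l'
  congr 1
  refine tsum_congr fun y => Finset.sum_congr rfl fun l' _ => ?_
  congr 1
  refine tsum_congr fun w => Finset.sum_congr rfl fun l _ => ?_
  congr 1
  exact hin w y l l'

/-- [folklore] **THE Λ PIECE OF LEVEL `ℓ` PUSHED `k` TIMES** (member `N = Lc^{ℓ+k+1}`): with the two OUTER legs of the sandwich bounded in
`StencilSlotE3HLeg`'s block-`ℓ¹` currency at rate `κ` ((N1): `|N^{d+2}·GamΦ_N α x′ l w| ≤ CA·e^{−κ|x′−quo N w|₁}`, `|N^{d+2}·wH_N κ l z| ≤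
CB·e^{−κ|quo N z|₁}`) and the TOP multiplier leg in the K-slot currency (`|N^{2(d+1)}·wΦ_N κ l y| ≤ CΦ·e^{−κ|y|₁}`, `StencilSlotE3PhiLeg`),
the normalised third-jet piece is bounded in the `BiLoc … u′ u′` shape of `LocStencil` by an EXPLICIT `(ℓ,k)`-free constant times
`(Lc⁻¹)^k`, at rate `κ/2`.  Inputs: `e3Lam_unit_split` (leaf-01), `inner_eq` (§2: the exact vertex pairing), `TaylorSandwich.sandwich_bound`
(owner), `TaylorMassLam` (leaf-11), `power_count`. -/
theorem abs_lam_piece_le (hr : r ∈ box (d + 1) Lc) (cΛ : ℝ) (ℓ k p : ℕ) (hp : p = ℓ + k + 1) {κ CA CB CΦ : ℝ} (hκ : 0 < κ) (hCΦ : 0 ≤ CΦ)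
    (hA : ∀ (α l : Fin (d + 1)) (x' w : Site (d + 1)),
      |((Lc : ℝ) ^ p) ^ (d + 2) * GamΦ (N := Lc ^ p) α x' l w| ≤
        CA * Real.exp (-κ * l1 (x' - quo (Lc ^ p) w)))
    (hB : ∀ (κ₁ l : Fin (d + 1)) (z : Site (d + 1)),
      |((Lc : ℝ) ^ p) ^ (d + 2) * wH (N := Lc ^ p) κ₁ l z| ≤ CB * Real.exp (-κ * l1 (quo (Lc ^ p) z)))
    (hΦ : ∀ (κ₁ l : Fin (d + 1)) (y : Site (d + 1)),
      |((Lc : ℝ) ^ p) ^ (2 * (d + 1)) * wΦ (N := Lc ^ p) κ₁ l y| ≤ CΦ * Real.exp (-κ * l1 y))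
    (κ' : Fin (d + 1)) (u' x' z' : Site (d + 1)) (a b : Fib d) :
    |((Lc : ℝ) ^ p) ^ (2 * (d + 1)) *
        e3OfS (Lc ^ p) (fun κ u => (((Lc : ℝ) ^ (d + 1)) ^ k * (cΛ * ((Lc : ℝ) ^ ℓ) ^ (2 * d + 4))) •
          symLagrIncAt d (toSite r) Lc (Lc ^ ℓ) (Lc ^ (ℓ + 1)) κ u) κ' u' x' z' a b| ≤
      |cΛ| / (Lc : ℝ) ^ (d + 1) *
        (((d : ℝ) + 1) * (CA * CB * (CΦ * Real.exp κ) * ((((8 * (d + 1) * (Lc + 1) + 1 : ℕ) : ℝ) ^ (d + 1)) * (((d : ℝ) + 1) * (((d : ℝ) + 1) *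
      ((((2 * (4 * (d + 1) + 1) + 1) ^ (d + 1) : ℕ) : ℝ) * (2 * (ell (d + 1) Lc : ℝ) ^ 2))))) *
          (Real.exp (κ * (((d : ℝ) + 1) * (4 * ((d : ℝ) + 1) * (Lc + 1)) + (d + 1))) *
            Real.exp (κ * (((d : ℝ) + 1) * ((4 * ((d : ℝ) + 1) + 1) + 1) + (d + 1))))) *
          Zl (d + 1) (κ / 2)) *
        ((Lc : ℝ) ^ (k + 2))⁻¹ * Real.exp (-(κ / 2) * (l1 (x' - u') + l1 (z' - u'))) := by
  subst hp
  have hL0 : (0 : ℝ) < Lc := by exact_mod_cast Nat.pos_of_ne_zero (NeZero.ne Lc)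
  have hL1 : (1 : ℝ) ≤ Lc := by exact_mod_cast (Nat.one_le_iff_ne_zero.2 (NeZero.ne Lc))
  have hcast : (((Lc ^ (ℓ + k + 1) : ℕ) : ℝ)) = (Lc : ℝ) ^ (ℓ + k + 1) := by push_cast; rfl
  have hNpos : (0 : ℝ) < ((Lc ^ (ℓ + k + 1) : ℕ) : ℝ) := by rw [hcast]; positivity
  have hCA : 0 ≤ CA := nonneg_of_dominated (Real.exp_pos _) (hA 0 0 x' 0)
  have hCB : 0 ≤ CB := nonneg_of_dominated (Real.exp_pos _) (hB 0 0 0)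
  have hZl : 0 ≤ Zl (d + 1) (κ / 2) := by unfold ExpKernelCalculus.Zl; exact tsum_nonneg fun _ => (Real.exp_pos _).le
  -- the zero blocks
  rcases a with α | ν
  swap
  · rw [e3OfS_inr, mul_zero, abs_zero]; positivity
  rcases b with β | ν'
  swap
  · rw [e3OfS_inl_inr, mul_zero, abs_zero]; positivity
  -- the ff block
  rw [piece_eq_pref_mul_sandwich hr cΛ ℓ k (ℓ + k + 1) rfl, abs_mul]
  refine (mul_le_mul_of_nonneg_left (abs_sandwich_le hr ℓ k (ℓ + k + 1) rfl hκ hCΦ hA hB hΦ κ' u' x' z' α β) (abs_nonneg _)).trans ?_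
  have habs : |-(cΛ / (Lc : ℝ) ^ (d + 1)) * (((Lc ^ (ℓ + k + 1) : ℕ) : ℝ)) ^ ((d : ℤ) - 2) * ((Lc : ℝ) ^ ℓ) ^ (d + 3)| =
      |cΛ| / (Lc : ℝ) ^ (d + 1) * ((((Lc ^ (ℓ + k + 1) : ℕ) : ℝ)) ^ ((d : ℤ) - 2) * ((Lc : ℝ) ^ ℓ) ^ (d + 3)) := by
    rw [abs_mul, abs_mul, abs_neg, abs_div, abs_of_pos (pow_pos hL0 _), abs_of_pos (zpow_pos hNpos _),
      abs_of_pos (pow_pos (pow_pos hL0 _) _), mul_assoc]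
  rw [habs]
  -- the power count
  have hSw : (((2 * (2 * (2 * (d + 1) * (Lc + 1) * Lc ^ ℓ)) + 1) ^ (d + 1) : ℕ) : ℝ) ≤ (((8 * (d + 1) * (Lc + 1) + 1 : ℕ) : ℝ) ^ (d + 1)) * ((Lc : ℝ) ^ ℓ) ^ (d + 1) := by
    rw [← mul_pow]
    push_cast
    refine pow_le_pow_left₀ (by positivity) ?_ _
    have hM1 : (1 : ℝ) ≤ (Lc : ℝ) ^ ℓ := one_le_pow₀ hL1
    nlinarith [hM1, show (0 : ℝ) ≤ 8 * ((d : ℝ) + 1) * (Lc + 1) by positivity]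
  have hPC := power_count (d := d) (Lc := Lc) ℓ k
  set M0 : ℝ := ((d : ℝ) + 1) * (((d : ℝ) + 1) *
      ((((2 * (4 * (d + 1) + 1) + 1) ^ (d + 1) : ℕ) : ℝ) * (2 * (ell (d + 1) Lc : ℝ) ^ 2))) with hM0
  have hM0' : 0 ≤ M0 := by positivity
  set PP : ℝ := ((Lc : ℝ) ^ (ℓ + k + 1)) ^ ((d : ℤ) - 2) * ((Lc : ℝ) ^ ℓ) ^ (d + 3) *
      (((Lc : ℝ) ^ (ℓ + k + 1)) ^ (d + 2) * (Lc : ℝ) ^ k * (((Lc : ℝ) ^ (ℓ + k + 1)) ^ (2 * (d + 1)))⁻¹) *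
      (((Lc : ℝ) ^ ℓ) ^ (2 * (d + 1)))⁻¹ with hPP
  have hPP' : 0 ≤ PP := by
    rw [hPP]
    exact mul_nonneg (mul_nonneg (mul_nonneg (zpow_pos (by positivity) _).le (by positivity)) (by positivity)) (by positivity)
  have key : (((Lc ^ (ℓ + k + 1) : ℕ) : ℝ)) ^ ((d : ℤ) - 2) * ((Lc : ℝ) ^ ℓ) ^ (d + 3) *
      (((((Lc ^ (ℓ + k + 1) : ℕ) : ℝ)) ^ (d + 2) * ((Lc : ℝ) ^ k * ((CΦ * (((Lc : ℝ) ^ (ℓ + k + 1)) ^ (2 * (d + 1)))⁻¹) * Real.exp κ))) *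
          ((((2 * (2 * (2 * (d + 1) * (Lc + 1) * Lc ^ ℓ)) + 1) ^ (d + 1) : ℕ) : ℝ) * (((d : ℝ) + 1) * (((d : ℝ) + 1) *
            ((((2 * (4 * (d + 1) + 1) + 1) ^ (d + 1) : ℕ) : ℝ) * (2 * (ell (d + 1) Lc : ℝ) ^ 2 / ((Lc : ℝ) ^ ℓ) ^ (2 * (d + 1)))))))) ≤
      (CΦ * Real.exp κ) * ((((8 * (d + 1) * (Lc + 1) + 1 : ℕ) : ℝ) ^ (d + 1)) * M0) * ((Lc : ℝ) ^ (k + 2))⁻¹ := by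
    rw [hcast]
    calc ((Lc : ℝ) ^ (ℓ + k + 1)) ^ ((d : ℤ) - 2) * ((Lc : ℝ) ^ ℓ) ^ (d + 3) *
      ((((Lc : ℝ) ^ (ℓ + k + 1)) ^ (d + 2) * ((Lc : ℝ) ^ k * ((CΦ * (((Lc : ℝ) ^ (ℓ + k + 1)) ^ (2 * (d + 1)))⁻¹) * Real.exp κ))) *
          ((((2 * (2 * (2 * (d + 1) * (Lc + 1) * Lc ^ ℓ)) + 1) ^ (d + 1) : ℕ) : ℝ) * (((d : ℝ) + 1) * (((d : ℝ) + 1) *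
            ((((2 * (4 * (d + 1) + 1) + 1) ^ (d + 1) : ℕ) : ℝ) * (2 * (ell (d + 1) Lc : ℝ) ^ 2 / ((Lc : ℝ) ^ ℓ) ^ (2 * (d + 1))))))))
        = (CΦ * Real.exp κ) * M0 * ((((2 * (2 * (2 * (d + 1) * (Lc + 1) * Lc ^ ℓ)) + 1) ^ (d + 1) : ℕ) : ℝ) * PP) := by
          rw [hM0, hPP]; ring
      _ ≤ (CΦ * Real.exp κ) * M0 * (((((8 * (d + 1) * (Lc + 1) + 1 : ℕ) : ℝ) ^ (d + 1)) * ((Lc : ℝ) ^ ℓ) ^ (d + 1)) * PP) :=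
          mul_le_mul_of_nonneg_left (mul_le_mul_of_nonneg_right hSw hPP') (by positivity)
      _ = (CΦ * Real.exp κ) * ((((8 * (d + 1) * (Lc + 1) + 1 : ℕ) : ℝ) ^ (d + 1)) * M0) *
          (((Lc : ℝ) ^ (ℓ + k + 1)) ^ ((d : ℤ) - 2) * ((Lc : ℝ) ^ ℓ) ^ (d + 3) *
            (((Lc : ℝ) ^ (ℓ + k + 1)) ^ (d + 2) * (Lc : ℝ) ^ k * (((Lc : ℝ) ^ (ℓ + k + 1)) ^ (2 * (d + 1)))⁻¹) *
            (((Lc : ℝ) ^ ℓ) ^ (d + 1) * (((Lc : ℝ) ^ ℓ) ^ (2 * (d + 1)))⁻¹)) := by rw [hPP]; ring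
      _ = _ := by rw [hPC]
  -- final assembly
  set F : ℝ := |cΛ| / (Lc : ℝ) ^ (d + 1) * (((d : ℝ) + 1) * (CA * CB)) *
      (Real.exp (κ * (((d : ℝ) + 1) * (4 * ((d : ℝ) + 1) * (Lc + 1)) + (d + 1))) *
            Real.exp (κ * (((d : ℝ) + 1) * ((4 * ((d : ℝ) + 1) + 1) + 1) + (d + 1)))) *
      Zl (d + 1) (κ / 2) * Real.exp (-(κ / 2) * (l1 (x' - u') + l1 (z' - u'))) with hF
  have hF0 : 0 ≤ F := by rw [hF]; positivity
  calc |cΛ| / (Lc : ℝ) ^ (d + 1) * ((((Lc ^ (ℓ + k + 1) : ℕ) : ℝ)) ^ ((d : ℤ) - 2) * ((Lc : ℝ) ^ ℓ) ^ (d + 3)) *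
      (((d : ℝ) + 1) * (CA * CB *
          ((((Lc ^ (ℓ + k + 1) : ℕ) : ℝ)) ^ (d + 2) * ((Lc : ℝ) ^ k * ((CΦ * (((Lc : ℝ) ^ (ℓ + k + 1)) ^ (2 * (d + 1)))⁻¹) * Real.exp κ))) *
          ((((2 * (2 * (2 * (d + 1) * (Lc + 1) * Lc ^ ℓ)) + 1) ^ (d + 1) : ℕ) : ℝ) * (((d : ℝ) + 1) * (((d : ℝ) + 1) *
            ((((2 * (4 * (d + 1) + 1) + 1) ^ (d + 1) : ℕ) : ℝ) * (2 * (ell (d + 1) Lc : ℝ) ^ 2 / ((Lc : ℝ) ^ ℓ) ^ (2 * (d + 1))))))) *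
          (Real.exp (κ * (((d : ℝ) + 1) * (4 * ((d : ℝ) + 1) * (Lc + 1)) + (d + 1))) *
            Real.exp (κ * (((d : ℝ) + 1) * ((4 * ((d : ℝ) + 1) + 1) + 1) + (d + 1))))) *
        Zl (d + 1) (κ / 2) * Real.exp (-(κ / 2) * (l1 (x' - u') + l1 (z' - u'))))
      = F * ((((Lc ^ (ℓ + k + 1) : ℕ) : ℝ)) ^ ((d : ℤ) - 2) * ((Lc : ℝ) ^ ℓ) ^ (d + 3) *
      (((((Lc ^ (ℓ + k + 1) : ℕ) : ℝ)) ^ (d + 2) * ((Lc : ℝ) ^ k * ((CΦ * (((Lc : ℝ) ^ (ℓ + k + 1)) ^ (2 * (d + 1)))⁻¹) * Real.exp κ))) *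
          ((((2 * (2 * (2 * (d + 1) * (Lc + 1) * Lc ^ ℓ)) + 1) ^ (d + 1) : ℕ) : ℝ) * (((d : ℝ) + 1) * (((d : ℝ) + 1) *
            ((((2 * (4 * (d + 1) + 1) + 1) ^ (d + 1) : ℕ) : ℝ) * (2 * (ell (d + 1) Lc : ℝ) ^ 2 / ((Lc : ℝ) ^ ℓ) ^ (2 * (d + 1))))))))) := by
        rw [hF]; ring
    _ ≤ F * ((CΦ * Real.exp κ) * ((((8 * (d + 1) * (Lc + 1) + 1 : ℕ) : ℝ) ^ (d + 1)) * M0) * ((Lc : ℝ) ^ (k + 2))⁻¹) :=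
        mul_le_mul_of_nonneg_left key hF0
    _ = _ := by rw [hF, hM0]; ring

end Piece

/-! ## §5 Row S3-L of the SHAPE table at `d = 3` (`θ = Lc⁻¹`): the hypothesis `hL` of `StencilSlotE3OfPieces.e3Shape_of_pieces` -/

section Row

variable {Lc : ℕ} [NeZero Lc]

/-- [folklore] **ROW S3-L OF THE SHAPE TABLE AT THE IN-BLOCK ROOT** (`d = 3`; constant BEFORE the root; the hypothesis `hL` of the owner's END `StencilSlotE3OfPieces.e3Shape_of_pieces`
∕ the typer's `S3.ShapeL 3 Lc cΛ cL θ δ` VERBATIM, with `θ = Lc⁻¹`, `δ = κ/2`): GIVEN the two outer legs of every member in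
`StencilSlotE3HLeg.legs_three`'s currency (`hN1`, `hG`; (N1) = leaf-16's `FineReadoutDecay` underneath) and the top multiplier leg in
`StencilSlotE3PhiLeg.phiLeg_three`'s currency (`hΦ`; the K-slot underneath, unconditional at `d = 3`), the Λ increment of level `m+1` pushed
`n − m` times is a local stencil family with constant `cL·(Lc⁻¹)^{n−m}`, `cL` free of `(n, m)`.  Row S3-L is thereby REDUCED IN THE KERNEL to
those two leg modules; nothing else is assumed. -/
theorem rowL_of_legs_at (cΛ : ℝ) {κ CH CΦ : ℝ} (hκ : 0 < κ) (hCΦ : 0 ≤ CΦ)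
    (hN1 : ∀ (j : ℕ) (κ₁ l : Fin (3 + 1)) (z : Site (3 + 1)),
      |((Lc : ℝ) ^ (j + 1)) ^ (3 + 2) * wH (N := Lc ^ (j + 1)) κ₁ l z| ≤ CH * Real.exp (-κ * l1 (quo (Lc ^ (j + 1)) z)))
    (hG : ∀ (j : ℕ) (α l : Fin (3 + 1)) (x' w : Site (3 + 1)),
      |((Lc : ℝ) ^ (j + 1)) ^ (3 + 2) * GamΦ (N := Lc ^ (j + 1)) α x' l w| ≤
        CH * Real.exp (-κ * l1 (x' - quo (Lc ^ (j + 1)) w)))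
    (hΦ : ∀ (j : ℕ) (κ₁ l : Fin (3 + 1)) (y : Site (3 + 1)),
      |((Lc : ℝ) ^ (j + 1)) ^ (2 * (3 + 1)) * wΦ (N := Lc ^ (j + 1)) κ₁ l y| ≤ CΦ * Real.exp (-κ * l1 y)) :
    ∃ cL : ℝ, ∀ (r : Fin (3 + 1) → ℕ), r ∈ box (3 + 1) Lc → ∀ n m : ℕ, m < n →
      LocStencil (fun κ' u' x' z' a b => ((Lc : ℝ) ^ (n + 1 + 1)) ^ (2 * (3 + 1)) *
        e3OfS (Lc ^ (n + 1 + 1)) (fun κ u => (((Lc : ℝ) ^ (3 + 1)) ^ (n - m) * (cΛ * ((Lc : ℝ) ^ (m + 1)) ^ (2 * 3 + 4))) •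
          symLagrIncAt 3 (toSite r) Lc (Lc ^ (m + 1)) (Lc ^ (m + 1 + 1)) κ u) κ' u' x' z' a b) (cL * ((Lc : ℝ)⁻¹) ^ (n - m)) (κ / 2) := by
  refine ⟨|cΛ| / (Lc : ℝ) ^ (3 + 1) *
        ((((3 : ℕ) : ℝ) + 1) * (CH * CH * (CΦ * Real.exp κ) * ((((8 * (3 + 1) * (Lc + 1) + 1 : ℕ) : ℝ) ^ (3 + 1)) * ((((3 : ℕ) : ℝ) + 1) * ((((3 : ℕ) : ℝ) + 1) *
      ((((2 * (4 * (3 + 1) + 1) + 1) ^ (3 + 1) : ℕ) : ℝ) * (2 * (ell (3 + 1) Lc : ℝ) ^ 2))))) *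
          (Real.exp (κ * ((((3 : ℕ) : ℝ) + 1) * (4 * (((3 : ℕ) : ℝ) + 1) * (Lc + 1)) + (((3:ℕ):ℝ) + 1))) *
            Real.exp (κ * ((((3 : ℕ) : ℝ) + 1) * ((4 * (((3 : ℕ) : ℝ) + 1) + 1) + 1) + (((3:ℕ):ℝ) + 1))))) *
          Zl (3 + 1) (κ / 2)) * ((Lc : ℝ) ^ 2)⁻¹, fun r hr n m hmn κ' u' x' z' a b => ?_⟩
  have h := abs_lam_piece_le (d := 3) (Lc := Lc) hr cΛ (m + 1) (n - m) (n + 1 + 1) (by omega) hκ hCΦ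
    (fun α l x' w => hG (n + 1) α l x' w) (fun κ₁ l z => hN1 (n + 1) κ₁ l z) (fun κ₁ l y => hΦ (n + 1) κ₁ l y) κ' u' x' z' a b
  rw [inv_pow_succ_succ] at h
  refine h.trans (le_of_eq ?_)
  push_cast
  ring

/-- [folklore] **ROW S3-L OF THE SHAPE TABLE AT EVERY IN-BLOCK ROOT, UNCONDITIONALLY AT `d = 3`** (constants `cL, δL` BEFORE the root `r ∈ box (3+1) Lc` — the (ρ-c) END `rowL_three_at` in the owner's W5 shape) (every `Lc` with `NeZero Lc`): the hypothesis `hL` of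
`StencilSlotE3OfPieces.e3Shape_of_pieces` ∕ `S3.ShapeL 3 Lc cΛ cL θ δ`, with `θ = Lc⁻¹`, from the TREE theorems `StencilSlotE3HLeg.legs_three`
((N1) `FineReadoutDecay` inside) and `StencilSlotE3PhiLeg.phiLeg_three` (the K-slot inside) at the common rate `min κ δ`.  Discharges ONE of the
twelve per-piece estimates of the S-slot table; NOT (hS, hSall) by itself, NOT BetaPertH, NOT continuum, NOT Clay. -/
theorem rowL_three_at (cΛ : ℝ) : ∃ cL δL : ℝ, 0 < δL ∧ ∀ (r : Fin (3 + 1) → ℕ), r ∈ box (3 + 1) Lc → ∀ n m : ℕ, m < n →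
    LocStencil (fun κ' u' x' z' a b => ((Lc : ℝ) ^ (n + 1 + 1)) ^ (2 * (3 + 1)) *
      e3OfS (Lc ^ (n + 1 + 1)) (fun κ u => (((Lc : ℝ) ^ (3 + 1)) ^ (n - m) * (cΛ * ((Lc : ℝ) ^ (m + 1)) ^ (2 * 3 + 4))) •
        symLagrIncAt 3 (toSite r) Lc (Lc ^ (m + 1)) (Lc ^ (m + 1 + 1)) κ u) κ' u' x' z' a b) (cL * ((Lc : ℝ)⁻¹) ^ (n - m)) δL := by
  obtain ⟨CH, κ, hκ, hCH, hH, hG⟩ := legs_three (Lc := Lc)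
  obtain ⟨CΦ, δ, hδ, hCΦ, hΦ1, -⟩ := phiLeg_three (Lc := Lc)
  set ρ : ℝ := min κ δ with hρ
  have hρ0 : 0 < ρ := lt_min hκ hδ
  have hρκ : ρ ≤ κ := min_le_left _ _
  have hρδ : ρ ≤ δ := min_le_right _ _
  have hN1 : ∀ (j : ℕ) (κ₁ l : Fin (3 + 1)) (z : Site (3 + 1)),
      |((Lc : ℝ) ^ (j + 1)) ^ (3 + 2) * wH (N := Lc ^ (j + 1)) κ₁ l z| ≤ CH * Real.exp (-ρ * l1 (quo (Lc ^ (j + 1)) z)) := by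
    intro j κ₁ l z
    have h := hH j κ₁ l z 0
    rw [smul_zero, sub_zero, sub_zero] at h
    exact h.trans (mul_exp_mono_rate hCH hρκ (l1_nonneg _))
  have hG' : ∀ (j : ℕ) (α l : Fin (3 + 1)) (x' w : Site (3 + 1)),
      |((Lc : ℝ) ^ (j + 1)) ^ (3 + 2) * GamΦ (N := Lc ^ (j + 1)) α x' l w| ≤
        CH * Real.exp (-ρ * l1 (x' - quo (Lc ^ (j + 1)) w)) := fun j α l x' w =>
    (hG j α l x' w).trans (mul_exp_mono_rate hCH hρκ (l1_nonneg _))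
  have hΦ : ∀ (j : ℕ) (κ₁ l : Fin (3 + 1)) (y : Site (3 + 1)),
      |((Lc : ℝ) ^ (j + 1)) ^ (2 * (3 + 1)) * wΦ (N := Lc ^ (j + 1)) κ₁ l y| ≤ CΦ * Real.exp (-ρ * l1 y) := by
    intro j κ₁ l y
    haveI : NeZero (Lc ^ (j + 1)) := ⟨pow_ne_zero _ (NeZero.ne Lc)⟩
    have h := hΦ1 j y (((Lc ^ (j + 1) : ℕ) : ℤ) • (0 : Site (3 + 1))) κ₁ l
    rw [KInv_inr_inr_coarse, quo_zsmul, sub_zero] at h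
    exact h.trans (mul_exp_mono_rate hCΦ hρδ (l1_nonneg _))
  obtain ⟨cL, hcL⟩ := rowL_of_legs_at (Lc := Lc) cΛ hρ0 hCΦ hN1 hG' hΦ
  exact ⟨cL, ρ / 2, half_pos hρ0, hcL⟩



end Row

end Summit.QuantumFields.BalabanUV.Beta.GAN24.TaylorRowLamSymAt

end
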